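import Summits.QuantumFields.BalabanUV.Beta.GAN24.DerivativeRateTransferLoewnerGramSchedule
import Summits.QuantumFields.BalabanUV.Beta.GAN24.DerivativeRateTransferLoewnerGramBounded
import Summits.QuantumFields.BalabanUV.Beta.GAN24.DerivativeRateTransferLoewnerGramMass

/-!
# `BalabanUV.Beta.GAN24.DerivativeRateTransferLoewnerGramScheduleLedger` — binder row G-an2-4 ∕ (CONV-C), route R6 «VALUES, NOT DERIVATIVES», PART 96:
# THE SCHEDULED TOWER END WITH ITS LEDGER AS HYPOTHESES — PART 88's END with `hB` and `hN` DISCHARGED (PART 94 + PART 95): what is quantified over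
# is exactly the structural tower data, the (STAB) family with its two schedules, (CONS), the level-0 diagonal, and LATTICE LETTERS
# (unit b2b-balaban-gan24-p3, gen 48; v1)

NOT IN PRINT; OUR PROOF (for the ROUTE; PART 88 `towerEnd_of_stabFamily_of_schedules` ∕ `exists_effForm_limit_of_stabFamily_of_schedules`, PART 94
`abs_effForm_le_of_cons` ∕ `effForm_diag_le_of_cons`, PART 95 `abs_gram_minOp_schedule_of_coercive` BY NAME — three `exact`s).  HONEST FRAMING (cell
contract, verbatim): «discharging `BetaPertH` makes Bałaban's UV stability UNCONDITIONAL — a real constructive-QFT result; it is NOT the continuum limit and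
NOT the Clay problem.»  HONEST DEPENDENCY (verbatim): «continuum YM on T⁴ ⇐ BetaPertH ∧ nine spine estimates (0/9 proved); BetaPertH ⇐ (D1) ∧ (D4) ∧
CAP+tail; G-an2-4 gates asym, D1 and NE2/3/4.»

WHY THIS FILE.  The input ledger of the sup-road END was prose (`HOME/b2b-balaban-gan24-p3/gen47/R6-SCHEDULE-NOTE.md` §4).  After PART 94 (`hB` from (CONS))
and PART 95 (`hN` from coercivity + reference fields) the END can be stated with NO k-uniform estimate among its hypotheses except the ones that ARE the
route's open inputs, and this file does so, so that «what remains» is a hypothesis list the kernel has checked to be sufficient: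
 (i) STRUCTURE — PSD fine forms `H j`, nonsingular bordered matrices, `Qc (j+1) = Qc j·Qf j`, `Qc (j+1)·P j = Qc j`, PSD carriers `G j`;
 (ii) (STAB) FAMILY — `∀ s > 0, 0 ≤ ((1+s)(1+e_j))•H_{j+1} + ((1+s⁻¹)τ_j²)•G_{j+1} − Qf_jᵀH_jQf_j` with the POLAR schedule `0 ≤ e_j ≤ E₀θ_p^j` [TYPED from the
      plaquette letter: PARTs 85 ∕ 89] and the MISMATCH schedule `0 ≤ τ_j ≤ M₀θ_m^j` [UNTYPED — R9°];
 (iii) (CONS) `≤ cst·θ^j` [UNTYPED — R8°];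
 (iv) the LEVEL-0 diagonal `𝒮_0(y,y) ≤ B₀` [a finite datum];
 (v) LATTICE LETTERS — carrier bounds `⟨v,G_jv⟩ ≤ g_j|v|²`, coercivity `γ_j|z|² ≤ ⟨z,H_jz⟩` on `ker Qc_j` [PART 93 on the block lattice], reference fields
      `Qc_j r_{j,a} = e_a` with energies `≤ E_j` and masses `≤ ρ_j`, and the GROWTH COUNT `g_j·(4(B + E_j)∕γ_j + 2ρ_j) ≤ N₀Λ^j` (`B = B₀ + cst∕(1−θ)`);
 (vi) RATES — `0 < θ < 1`, `0 ≤ θ_p ≤ θ`, and `hrate : θ_m²Λ ≤ θ²`.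
Conclusion: `|𝒮_{j+1}(a,b) − 𝒮_j(a,b)| ≤ (cst + 2(1 + 2E₀)B + 4M₀²N₀Λ)·θ^j` and the limit form `𝒮_∞` with tail `·θ^j∕(1−θ)` ((CONV-C)'s shape: k-uniform
constants, one-step rate).  Bałaban-class among (i)–(vi): (ii)'s `τ_j` and (iii) — nothing else.

WHAT THIS FILE PROVES (0 sorry, 0 `def`, nothing cited): **`towerEnd_ledger`**, **`leg_energy_rate_ledger`**, **`exists_effForm_limit_ledger`**.
WHAT IT DOES NOT DO: supply (ii)'s `τ_j` or (iii); count `Λ` for Bałaban's tower (instantiate (v)); the RMS road (PART 90 ∕ 91's weighted END keeps `hW`,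
whose reduction is (H2)-style and sharper).  SUPPLIER work on route C-R6° (rank 2, REDUCTION); no consumer of record; NEVER «G-an2-4 closed»; NOT (CONV-C),
NOT D1, NOT `BetaPertH`, NOT continuum, NOT Clay.  Records: `HOME/b2b-balaban-gan24-p3/WOODBURY-FIBRE.md` v14.8, `HOME/b2b-balaban-gan24-p3/gen48/README.md`.
-/

noncomputable section

open Set Matrix Finset Filter Topology

namespace Summit.QuantumFields.BalabanUV.Beta.GAN24.DerivativeRateTransferLoewnerGramScheduleLedger

open Literature.MathematicalPhysics.QuantumFieldTheory.Balaban1983to89.Beta.Composition (kkt)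
open Literature.MathematicalPhysics.QuantumFieldTheory.Balaban1983to89.Beta.CompositionSingular (effForm minOp)
open Summit.QuantumFields.BalabanUV.Beta.GAN24.DerivativeRateTransferLoewnerKKT (transpose_eq_of_posSemidef)
open Summit.QuantumFields.BalabanUV.Beta.GAN24.DerivativeRateTransferLoewnerGramSchedule (towerEnd_of_stabFamily_of_schedules
  leg_energy_rate_of_stabFamily_of_schedules exists_effForm_limit_of_stabFamily_of_schedules)
open Summit.QuantumFields.BalabanUV.Beta.GAN24.DerivativeRateTransferLoewnerGramBounded (abs_effForm_le_of_cons effForm_diag_le_of_cons)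
open Summit.QuantumFields.BalabanUV.Beta.GAN24.DerivativeRateTransferLoewnerGramMass (abs_gram_minOp_schedule_of_coercive)

variable {c : Type*} [Fintype c] [DecidableEq c]
variable {ι : ℕ → Type*} [∀ j, Fintype (ι j)] [∀ j, DecidableEq (ι j)]
variable {H : ∀ j, Matrix (ι j) (ι j) ℝ} {Qf : ∀ j, Matrix (ι j) (ι (j + 1)) ℝ} {Qc : ∀ j, Matrix c (ι j) ℝ}
variable {P : ∀ j, Matrix (ι (j + 1)) (ι j) ℝ} {G : ∀ j, Matrix (ι j) (ι j) ℝ} {e τ g γ E ρ : ℕ → ℝ} {r : ∀ j, c → ι j → ℝ}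
variable {cst B₀ E₀ M₀ N₀ Λ θ θp θm : ℝ}

/-- **`towerEnd_ledger` — THE SCHEDULED TOWER END, LEDGER FORM** [our proof; PART 88 + PART 94 + PART 95]: hypotheses (i)–(vi) of the module docstring ⟹
`|𝒮_{j+1}(a,b) − 𝒮_j(a,b)| ≤ (cst + 2(1 + 2E₀)(B₀ + cst∕(1−θ)) + 4M₀²N₀Λ)·θ^j` for all `j, a, b`. -/
theorem towerEnd_ledger (hH : ∀ j, (H j).PosSemidef) (hk : ∀ j, IsUnit (kkt (H j) (Qc j)).det)
    (hcomp : ∀ j, Qc (j + 1) = Qc j * Qf j) (hPQ : ∀ j, Qc (j + 1) * P j = Qc j) (hGp : ∀ j, (G j).PosSemidef)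
    (hstab : ∀ j (s : ℝ), 0 < s →
      ((((1 + s) * (1 + e j)) • H (j + 1) + ((1 + s⁻¹) * τ j ^ 2) • G (j + 1) - (Qf j)ᵀ * H j * Qf j).PosSemidef))
    (he : ∀ j, 0 ≤ e j ∧ e j ≤ E₀ * θp ^ j) (hτ : ∀ j, 0 ≤ τ j ∧ τ j ≤ M₀ * θm ^ j)
    (hcons : ∀ j (y : c), (minOp (H j) (Qc j) *ᵥ Pi.single y 1) ⬝ᵥ
        (((P j)ᵀ * H (j + 1) * P j - H j) *ᵥ (minOp (H j) (Qc j) *ᵥ Pi.single y 1)) ≤ cst * θ ^ j)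
    (hB₀ : ∀ y, effForm (H 0) (Qc 0) y y ≤ B₀)
    (hg0 : ∀ j, 0 ≤ g j) (hγ : ∀ j, 0 < γ j) (hg : ∀ j (v : ι j → ℝ), v ⬝ᵥ (G j *ᵥ v) ≤ g j * (v ⬝ᵥ v))
    (hcoer : ∀ j (z : ι j → ℝ), Qc j *ᵥ z = 0 → γ j * (z ⬝ᵥ z) ≤ z ⬝ᵥ (H j *ᵥ z))
    (hr : ∀ j a, Qc j *ᵥ r j a = Pi.single a 1) (hE : ∀ j a, r j a ⬝ᵥ (H j *ᵥ r j a) ≤ E j) (hρ : ∀ j a, r j a ⬝ᵥ r j a ≤ ρ j)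
    (hn : ∀ j, g j * (4 * ((B₀ + cst / (1 - θ)) + E j) / γ j + 2 * ρ j) ≤ N₀ * Λ ^ j)
    (hcst : 0 ≤ cst) (hθ : 0 < θ) (hθ1 : θ < 1) (hθp : 0 ≤ θp) (hθpθ : θp ≤ θ) (hE₀ : 0 ≤ E₀) (hN₀ : 0 ≤ N₀) (hΛ : 0 ≤ Λ)
    (hrate : θm ^ 2 * Λ ≤ θ ^ 2) :
    ∀ j (a b : c), |effForm (H (j + 1)) (Qc (j + 1)) a b - effForm (H j) (Qc j) a b| ≤
      (cst + 2 * (1 + 2 * E₀) * (B₀ + cst / (1 - θ)) + 4 * (M₀ ^ 2 * N₀ * Λ)) * θ ^ j :=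
  towerEnd_of_stabFamily_of_schedules hH hk hcomp hPQ (fun j => transpose_eq_of_posSemidef (hGp j)) hstab hcons
    (abs_effForm_le_of_cons hH hk hPQ hcst hθ.le hθ1 hcons hB₀) he hτ
    (abs_gram_minOp_schedule_of_coercive hH hk hGp hg0 hγ hg hcoer r hr hE hρ
      (effForm_diag_le_of_cons hH hk hPQ hcst hθ.le hθ1 hcons hB₀) hn)
    hθ hθ1.le hθp hθpθ hE₀ hN₀ hΛ hrate

/-- **`leg_energy_rate_ledger` — THE MINIMISER LEGS IN ENERGY CURRENCY, LEDGER FORM** [our proof]: under the same hypotheses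
`⟨P_jℋ_je_y − ℋ_{j+1}e_y, H_{j+1}(P_jℋ_je_y − ℋ_{j+1}e_y)⟩ ≤ (cst + (1 + 2E₀)(B₀ + cst∕(1−θ)) + 2M₀²N₀Λ)·θ^j` for all `j, y`. -/
theorem leg_energy_rate_ledger (hH : ∀ j, (H j).PosSemidef) (hk : ∀ j, IsUnit (kkt (H j) (Qc j)).det)
    (hcomp : ∀ j, Qc (j + 1) = Qc j * Qf j) (hPQ : ∀ j, Qc (j + 1) * P j = Qc j) (hGp : ∀ j, (G j).PosSemidef)
    (hstab : ∀ j (s : ℝ), 0 < s →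
      ((((1 + s) * (1 + e j)) • H (j + 1) + ((1 + s⁻¹) * τ j ^ 2) • G (j + 1) - (Qf j)ᵀ * H j * Qf j).PosSemidef))
    (he : ∀ j, 0 ≤ e j ∧ e j ≤ E₀ * θp ^ j) (hτ : ∀ j, 0 ≤ τ j ∧ τ j ≤ M₀ * θm ^ j)
    (hcons : ∀ j (y : c), (minOp (H j) (Qc j) *ᵥ Pi.single y 1) ⬝ᵥ
        (((P j)ᵀ * H (j + 1) * P j - H j) *ᵥ (minOp (H j) (Qc j) *ᵥ Pi.single y 1)) ≤ cst * θ ^ j)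
    (hB₀ : ∀ y, effForm (H 0) (Qc 0) y y ≤ B₀)
    (hg0 : ∀ j, 0 ≤ g j) (hγ : ∀ j, 0 < γ j) (hg : ∀ j (v : ι j → ℝ), v ⬝ᵥ (G j *ᵥ v) ≤ g j * (v ⬝ᵥ v))
    (hcoer : ∀ j (z : ι j → ℝ), Qc j *ᵥ z = 0 → γ j * (z ⬝ᵥ z) ≤ z ⬝ᵥ (H j *ᵥ z))
    (hr : ∀ j a, Qc j *ᵥ r j a = Pi.single a 1) (hE : ∀ j a, r j a ⬝ᵥ (H j *ᵥ r j a) ≤ E j) (hρ : ∀ j a, r j a ⬝ᵥ r j a ≤ ρ j)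
    (hn : ∀ j, g j * (4 * ((B₀ + cst / (1 - θ)) + E j) / γ j + 2 * ρ j) ≤ N₀ * Λ ^ j)
    (hcst : 0 ≤ cst) (hθ : 0 < θ) (hθ1 : θ < 1) (hθp : 0 ≤ θp) (hθpθ : θp ≤ θ) (hE₀ : 0 ≤ E₀) (hN₀ : 0 ≤ N₀) (hΛ : 0 ≤ Λ)
    (hrate : θm ^ 2 * Λ ≤ θ ^ 2) :
    ∀ j (y : c), (P j *ᵥ (minOp (H j) (Qc j) *ᵥ Pi.single y 1) - minOp (H (j + 1)) (Qc (j + 1)) *ᵥ Pi.single y 1) ⬝ᵥ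
        (H (j + 1) *ᵥ (P j *ᵥ (minOp (H j) (Qc j) *ᵥ Pi.single y 1) - minOp (H (j + 1)) (Qc (j + 1)) *ᵥ Pi.single y 1)) ≤
      (cst + (1 + 2 * E₀) * (B₀ + cst / (1 - θ)) + 2 * (M₀ ^ 2 * N₀ * Λ)) * θ ^ j :=
  leg_energy_rate_of_stabFamily_of_schedules hH hk hcomp hPQ (fun j => transpose_eq_of_posSemidef (hGp j)) hstab hcons
    (abs_effForm_le_of_cons hH hk hPQ hcst hθ.le hθ1 hcons hB₀) he hτ
    (abs_gram_minOp_schedule_of_coercive hH hk hGp hg0 hγ hg hcoer r hr hE hρ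
      (effForm_diag_le_of_cons hH hk hPQ hcst hθ.le hθ1 hcons hB₀) hn)
    hθ hθ1.le hθp hθpθ hE₀ hN₀ hΛ hrate

/-- **`exists_effForm_limit_ledger` — THE LIMIT FORM WITH THE (CONV-C)-SHAPED TAIL, LEDGER FORM** [our proof]: under the same hypotheses there is
`𝒮_∞ : Matrix c c ℝ` with `𝒮_j(a,b) → 𝒮_∞(a,b)` and `|𝒮_j(a,b) − 𝒮_∞(a,b)| ≤ (cst + 2(1 + 2E₀)(B₀ + cst∕(1−θ)) + 4M₀²N₀Λ)·θ^j∕(1−θ)` for all `j, a, b`. -/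
theorem exists_effForm_limit_ledger (hH : ∀ j, (H j).PosSemidef) (hk : ∀ j, IsUnit (kkt (H j) (Qc j)).det)
    (hcomp : ∀ j, Qc (j + 1) = Qc j * Qf j) (hPQ : ∀ j, Qc (j + 1) * P j = Qc j) (hGp : ∀ j, (G j).PosSemidef)
    (hstab : ∀ j (s : ℝ), 0 < s →
      ((((1 + s) * (1 + e j)) • H (j + 1) + ((1 + s⁻¹) * τ j ^ 2) • G (j + 1) - (Qf j)ᵀ * H j * Qf j).PosSemidef))
    (he : ∀ j, 0 ≤ e j ∧ e j ≤ E₀ * θp ^ j) (hτ : ∀ j, 0 ≤ τ j ∧ τ j ≤ M₀ * θm ^ j)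
    (hcons : ∀ j (y : c), (minOp (H j) (Qc j) *ᵥ Pi.single y 1) ⬝ᵥ
        (((P j)ᵀ * H (j + 1) * P j - H j) *ᵥ (minOp (H j) (Qc j) *ᵥ Pi.single y 1)) ≤ cst * θ ^ j)
    (hB₀ : ∀ y, effForm (H 0) (Qc 0) y y ≤ B₀)
    (hg0 : ∀ j, 0 ≤ g j) (hγ : ∀ j, 0 < γ j) (hg : ∀ j (v : ι j → ℝ), v ⬝ᵥ (G j *ᵥ v) ≤ g j * (v ⬝ᵥ v))
    (hcoer : ∀ j (z : ι j → ℝ), Qc j *ᵥ z = 0 → γ j * (z ⬝ᵥ z) ≤ z ⬝ᵥ (H j *ᵥ z))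
    (hr : ∀ j a, Qc j *ᵥ r j a = Pi.single a 1) (hE : ∀ j a, r j a ⬝ᵥ (H j *ᵥ r j a) ≤ E j) (hρ : ∀ j a, r j a ⬝ᵥ r j a ≤ ρ j)
    (hn : ∀ j, g j * (4 * ((B₀ + cst / (1 - θ)) + E j) / γ j + 2 * ρ j) ≤ N₀ * Λ ^ j)
    (hcst : 0 ≤ cst) (hθ : 0 < θ) (hθ1 : θ < 1) (hθp : 0 ≤ θp) (hθpθ : θp ≤ θ) (hE₀ : 0 ≤ E₀) (hN₀ : 0 ≤ N₀) (hΛ : 0 ≤ Λ)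
    (hrate : θm ^ 2 * Λ ≤ θ ^ 2) :
    ∃ Sinf : Matrix c c ℝ, ∀ a b : c, Tendsto (fun j => effForm (H j) (Qc j) a b) atTop (𝓝 (Sinf a b)) ∧
      ∀ j, |effForm (H j) (Qc j) a b - Sinf a b| ≤
        (cst + 2 * (1 + 2 * E₀) * (B₀ + cst / (1 - θ)) + 4 * (M₀ ^ 2 * N₀ * Λ)) * θ ^ j / (1 - θ) :=
  exists_effForm_limit_of_stabFamily_of_schedules hH hk hcomp hPQ (fun j => transpose_eq_of_posSemidef (hGp j)) hstab hcons
    (abs_effForm_le_of_cons hH hk hPQ hcst hθ.le hθ1 hcons hB₀) he hτ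
    (abs_gram_minOp_schedule_of_coercive hH hk hGp hg0 hγ hg hcoer r hr hE hρ
      (effForm_diag_le_of_cons hH hk hPQ hcst hθ.le hθ1 hcons hB₀) hn)
    hθ hθ1 hθp hθpθ hE₀ hN₀ hΛ hrate

end Summit.QuantumFields.BalabanUV.Beta.GAN24.DerivativeRateTransferLoewnerGramScheduleLedger

end
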